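import Mathlib
import Summits.KontsevichZagierPeriods.KontsevichZagierPeriods.Theses.TorsionLogs
import Summits.KontsevichZagierPeriods.KontsevichZagierPeriods.Theorems.HyperbolicBlochOffTetraSectorKernelRungZeroLogRelations
import Summits.KontsevichZagierPeriods.KontsevichZagierPeriods.Theorems.TorsionLogsNeronTorsionSectorStubParametersAlgebraic

/-!
# Line `NeronHeight` for crux `TorsionLogs.NeronTorsionFlex` (stmt-KontsevichZagierPeriods-13806)

Skeleton (forward rung over the PROVED floor `Cruxes.NeronTorsionSector.Translation.stub_assembly`
= `TorsionLogs.NeronTorsionPrimitiveChain`):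

* `stub_neronTorsionHeightChain` — the RUNG (load-bearing, L): the floor's Néron–torsion chain with its
  `∃`-log-carrier PINNED to division-polynomial data,
  `4N(N−2)·c·log B = q²·(4·log|ψ_{N−1}(x_P, y_P/2)| − N(N−2)·log(3e₁² − g₂/4))`
  ("the chain computes the archimedean Néron local height of the torsion point":
  `λ̃(u_P) − λ̃(ω₁/2) = rI.value + ρ²·rP.value`, `λ̃(u_P) = log|ψ_{N−1}(P)|/(N²−2N)`,
  `λ̃(ω₁/2) = ¼·log(3e₁²−g₂/4)` from `σ(nu) = ±ψₙ(P)σ(u)^{n²}` — `PeriodPair.weierstrassSigma_nat_mul`).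
* `stub_flexTorsionData` — support (M): the real flex of `Y² = X³ − 7X + 6` has order `3` and real
  elliptic logarithm `ω₁/3` (`3·∫_{x_P}^∞ dx/√f = 2·∫_2^∞ dx/√f`, `f = 4x³ − 28x + 24`).
* `NeronTorsionFlex_of` — COMPOSITION, proved here (no `sorry`): the rung at
  `(g₂, g₃, e₁, N, a, p, q) = (28, −24, 2, 3, 1, 1, 6)` gives `36•[rI] + [rP] − c•[rB] ∈ relations` with
  `c·log B = 12·log|y_P| − 9·log 5 = 3·log(f(x_P)²/125)`; the interval-log relation
  (`interval_log_relation_mem_relations`, landed) turns `B^c = (f(x_P)²/125)³` into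
  `c•[rB] − 3•[rL] ∈ relations`; add.
-/

-- single-conjunct summit: Sub = Summit, so the namespace segment repeats by design (CONVENTIONS §2)
set_option linter.dupNamespace false

namespace Summit.KontsevichZagierPeriods.KontsevichZagierPeriods.Cruxes.NeronTorsionFlex.NeronHeight

open Literature.NumberTheory.Transcendental
open Summit.KontsevichZagierPeriods.HyperbolicBloch.OffTetraSectorKernel (interval_log_relation_mem_relations)
open Summit.KontsevichZagierPeriods.KontsevichZagierPeriods.Cruxes.NeronTorsionSector.Translation
  (stub_parametersAlgebraic)

/-- The RUNG (crux of the line, L): the Néron–torsion chain with PINNED carrier; verbatim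
`Sketch.NeronTorsionHeightChain`. One step above the floor `NeronTorsionPrimitiveChain`
(same binders, same chain; the extra conjunct computes `c·log B`). -/
def NeronTorsionHeightChain : Prop :=
  ∀ (g₂ g₃ e₁ xP yP : ℝ) (N a p q : ℕ) (f : ℝ → ℝ), (∀ x, f x = 4 * x ^ 3 - g₂ * x - g₃) →
    g₂ ^ 3 - 27 * g₃ ^ 2 ≠ 0 → f e₁ = 0 → 0 < e₁ → (∀ x, e₁ < x → 0 < f x) → e₁ < xP →
    yP ^ 2 = f xP → 3 ≤ N → 0 < a → 2 * a < N →
    (∀ hns : (⟨0, 0, 0, -g₂ / 4, -g₃ / 4⟩ : WeierstrassCurve ℝ).toAffine.Nonsingular xP (yP / 2),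
      addOrderOf (WeierstrassCurve.Affine.Point.some xP (yP / 2) hns) = N) →
    (N : ℝ) * (∫ x in Set.Ioi xP, (Real.sqrt (f x))⁻¹) =
      a * (2 * ∫ x in Set.Ioi e₁, (Real.sqrt (f x))⁻¹) →
    Nat.Coprime p q → (q : ℤ) * ((N : ℤ) - 2 * (a : ℤ)) = (p : ℤ) * (2 * (N : ℤ)) →
    ∀ (rI rP : KZ.IntegralRep 2),
      rI.domain = {z | e₁ < z 1 ∧ z 1 < z 0 ∧ z 0 < xP} →
      Set.EqOn rI.integrand (fun z => z 1 / (Real.sqrt (f (z 1)) * Real.sqrt (f (z 0)))) rI.domain →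
      rP.domain = {z | e₁ < z 0 ∧ e₁ < z 1} →
      Set.EqOn rP.integrand
        (fun z => (Real.sqrt (f (z 0)))⁻¹ * ((g₂ * z 1 + 2 * g₃) / (2 * (z 1) ^ 2 * Real.sqrt (f (z 1)))))
        rP.domain →
      ∃ (c : ℤ) (B : ℝ) (rB : KZ.IntegralRep 1), 1 < B ∧ IsAlgebraic ℚ B ∧
        rB.domain = {t | 1 < t 0 ∧ t 0 < B} ∧ Set.EqOn rB.integrand (fun t => (t 0)⁻¹) rB.domain ∧
        ((q : ℤ) ^ 2) • KZ.of rI + ((p : ℤ) ^ 2) • KZ.of rP - c • KZ.of rB ∈ KZ.relations ∧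
        4 * (N : ℝ) * ((N : ℝ) - 2) * ((c : ℝ) * Real.log B) =
          (q : ℝ) ^ 2 * (4 * Real.log
              |((⟨0, 0, 0, -g₂ / 4, -g₃ / 4⟩ : WeierstrassCurve ℝ).ψ ((N : ℤ) - 1)).evalEval xP (yP / 2)|
            - (N : ℝ) * ((N : ℝ) - 2) * Real.log (3 * e₁ ^ 2 - g₂ / 4))

/-- SUPPORT (M): flex torsion data of `Y² = X³ − 7X + 6` — the real flex `(x_P, √f(x_P)/2)`
(`ψ₃(x_P) = 3x_P⁴ − 42x_P² + 72x_P − 49 = 0`, `x_P > 2`) has order `3`, and `3·u_P = ω₁`. -/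
def FlexTorsionData : Prop :=
  ∀ (xP : ℝ), 2 < xP → 3 * xP ^ 4 - 42 * xP ^ 2 + 72 * xP - 49 = 0 →
    (∀ hns : (⟨0, 0, 0, -28 / 4, -(-24) / 4⟩ : WeierstrassCurve ℝ).toAffine.Nonsingular xP
        (Real.sqrt (4 * xP ^ 3 - 28 * xP + 24) / 2),
      addOrderOf (WeierstrassCurve.Affine.Point.some xP (Real.sqrt (4 * xP ^ 3 - 28 * xP + 24) / 2) hns)
        = 3) ∧
    (3 : ℝ) * (∫ x in Set.Ioi xP, (Real.sqrt (4 * x ^ 3 - 28 * x + 24))⁻¹) =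
      (1 : ℝ) * (2 * ∫ x in Set.Ioi (2 : ℝ), (Real.sqrt (4 * x ^ 3 - 28 * x + 24))⁻¹)

/-- RUNG stub (registered obligation). -/
theorem stub_neronTorsionHeightChain : NeronTorsionHeightChain := by
  sorry

/-- SUPPORT stub (registered obligation). -/
theorem stub_flexTorsionData : FlexTorsionData := by
  sorry

/-- COMPOSITION (proved): pinned torsion chain + flex torsion data ⟹ `TorsionLogs.NeronTorsionFlex`. -/
theorem NeronTorsionFlex_of_stubs (hrung : NeronTorsionHeightChain) (hflex : FlexTorsionData) :
    Summit.KontsevichZagierPeriods.KontsevichZagierPeriods.Theses.TorsionLogs.NeronTorsionFlex := by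
  intro xP hxP hψ rI rP rL hIdom hIint hPdom hPint hLdom hLint
  -- the flex curve `f(x) = 4x³ − 28x + 24 = 4(x−2)(x−1)(x+3)`
  have hpos : ∀ x : ℝ, 2 < x → 0 < 4 * x ^ 3 - 28 * x + 24 := by
    intro x hx
    have h : 4 * x ^ 3 - 28 * x + 24 = 4 * ((x - 2) * (x - 1) * (x + 3)) := by ring
    rw [h]
    have h1 : 0 < x - 2 := sub_pos.2 hx
    have h2 : 0 < x - 1 := by linarith
    have h3 : 0 < x + 3 := by linarith
    positivity
  have hfP : 0 < 4 * xP ^ 3 - 28 * xP + 24 := hpos xP hxP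
  have hyP2 : Real.sqrt (4 * xP ^ 3 - 28 * xP + 24) ^ 2 = 4 * xP ^ 3 - 28 * xP + 24 :=
    Real.sq_sqrt hfP.le
  have hyPpos : 0 < Real.sqrt (4 * xP ^ 3 - 28 * xP + 24) := Real.sqrt_pos.2 hfP
  -- the flex root satisfies `x_P ≥ 5/2`, hence `f(x_P) ≥ 12` and `f(x_P)² ≥ 125`
  have ht : 1 / 2 ≤ xP - 2 := by
    by_contra h
    rw [not_le] at h
    have h0 : 0 < xP - 2 := sub_pos.2 hxP
    have h1 : (xP - 2) ^ 2 < 1 / 4 := by nlinarith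
    have h2 : (xP - 2) ^ 3 < 1 / 8 := by nlinarith
    have h3 : (xP - 2) ^ 4 < 1 / 16 := by nlinarith
    have hφ : 3 * (xP - 2) ^ 4 + 24 * (xP - 2) ^ 3 + 30 * (xP - 2) ^ 2 - 25 = 0 := by
      have : 3 * (xP - 2) ^ 4 + 24 * (xP - 2) ^ 3 + 30 * (xP - 2) ^ 2 - 25
          = 3 * xP ^ 4 - 42 * xP ^ 2 + 72 * xP - 49 := by ring
      rw [this, hψ]
    linarith
  have hf12 : 12 ≤ 4 * xP ^ 3 - 28 * xP + 24 := by
    have h0 : 0 < xP - 2 := sub_pos.2 hxP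
    have : 4 * xP ^ 3 - 28 * xP + 24 = 20 * (xP - 2) + 24 * (xP - 2) ^ 2 + 4 * (xP - 2) ^ 3 := by ring
    rw [this]; nlinarith
  have hsq : (1 : ℝ) ≤ (4 * xP ^ 3 - 28 * xP + 24) ^ 2 / 125 := by
    rw [le_div_iff₀ (by norm_num : (0:ℝ) < 125)]; nlinarith
  -- integrand conversion (`28·x′ − 48 = g₂·x′ + 2·g₃` with `g₂ = 28`, `g₃ = −24`)
  have hconv : (fun z : Fin 2 → ℝ => (Real.sqrt (4 * (z 0) ^ 3 - 28 * z 0 + 24))⁻¹ *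
        ((28 * z 1 - 48) / (2 * (z 1) ^ 2 * Real.sqrt (4 * (z 1) ^ 3 - 28 * z 1 + 24))))
      = (fun z : Fin 2 → ℝ => (Real.sqrt ((fun x : ℝ => 4 * x ^ 3 - 28 * x + 24) (z 0)))⁻¹ *
        (((28 : ℝ) * z 1 + 2 * (-24)) / (2 * (z 1) ^ 2 *
          Real.sqrt ((fun x : ℝ => 4 * x ^ 3 - 28 * x + 24) (z 1))))) := by
    funext z; norm_num [sub_eq_add_neg]
  have hPint' := hPint
  rw [hconv] at hPint'
  -- flex torsion data
  obtain ⟨htor, hper⟩ := hflex xP hxP hψ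
  have hper' : ((3 : ℕ) : ℝ) * (∫ x in Set.Ioi xP,
        (Real.sqrt ((fun x : ℝ => 4 * x ^ 3 - 28 * x + 24) x))⁻¹) =
      ((1 : ℕ) : ℝ) * (2 * ∫ x in Set.Ioi (2 : ℝ),
        (Real.sqrt ((fun x : ℝ => 4 * x ^ 3 - 28 * x + 24) x))⁻¹) := by
    simpa using hper
  -- algebraicity of `x_P` is forced by the representation `rI` (landed `stub_parametersAlgebraic`)
  have hxalg : IsAlgebraic ℚ xP :=
    (stub_parametersAlgebraic 28 (-24) 2 xP (fun x => 4 * x ^ 3 - 28 * x + 24) (fun x => by ring)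
      (by norm_num) (by norm_num) hpos hxP rI rP hIdom hIint hPdom hPint').2.2.2
  have hfalg : IsAlgebraic ℚ ((4 * xP ^ 3 - 28 * xP + 24) ^ 2 / 125) := by
    have h4 : IsAlgebraic ℚ ((4 : ℕ) : ℝ) := isAlgebraic_nat 4
    have h28 : IsAlgebraic ℚ ((28 : ℕ) : ℝ) := isAlgebraic_nat 28
    have h24 : IsAlgebraic ℚ ((24 : ℕ) : ℝ) := isAlgebraic_nat 24
    have h125 : IsAlgebraic ℚ ((125 : ℕ) : ℝ) := isAlgebraic_nat 125
    push_cast at h4 h28 h24 h125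
    rw [div_eq_mul_inv]
    exact ((((h4.mul (hxalg.pow 3)).sub (h28.mul hxalg)).add h24).pow 2).mul h125.inv
  -- the rung at the flex: `(g₂, g₃, e₁, N, a, p, q) = (28, −24, 2, 3, 1, 1, 6)`
  obtain ⟨c, B, rB, hB1, hBalg, hBdom, hBint, hchain, hpin⟩ :=
    hrung 28 (-24) 2 xP (Real.sqrt (4 * xP ^ 3 - 28 * xP + 24)) 3 1 1 6
      (fun x => 4 * x ^ 3 - 28 * x + 24) (fun x => by ring) (by norm_num) (by norm_num) (by norm_num)
      hpos hxP hyP2 le_rfl one_pos (by norm_num) htor hper' (by norm_num) (by norm_num)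
      rI rP hIdom hIint hPdom hPint'
  have hchain' : (36 : ℤ) • KZ.of rI + KZ.of rP - c • KZ.of rB ∈ KZ.relations := by
    simpa using hchain
  -- the pin at the flex: `ψ₂(x_P, y_P/2) = y_P`, `D = 5`, so `c·log B = 12·log y_P − 9·log 5`
  have hψ₂ : (((⟨0, 0, 0, -28 / 4, -(-24) / 4⟩ : WeierstrassCurve ℝ).ψ (((3 : ℕ) : ℤ) - 1)).evalEval xP
        (Real.sqrt (4 * xP ^ 3 - 28 * xP + 24) / 2)) = Real.sqrt (4 * xP ^ 3 - 28 * xP + 24) := by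
    have hidx : (((3 : ℕ) : ℤ) - 1) = 2 := by norm_num
    rw [hidx, WeierstrassCurve.ψ_two, WeierstrassCurve.ψ₂, WeierstrassCurve.Affine.evalEval_polynomialY]
    simp only [zero_mul, add_zero]
    ring
  rw [hψ₂, abs_of_pos hyPpos, Real.log_sqrt hfP.le] at hpin
  have hD : (3 * (2 : ℝ) ^ 2 - 28 / 4) = 5 := by norm_num
  rw [hD] at hpin
  push_cast at hpin
  have hlogq : Real.log ((4 * xP ^ 3 - 28 * xP + 24) ^ 2 / 125)
      = 2 * Real.log (4 * xP ^ 3 - 28 * xP + 24) - 3 * Real.log 5 := by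
    rw [Real.log_div (by positivity) (by norm_num), Real.log_pow,
      show (125 : ℝ) = 5 ^ 3 by norm_num, Real.log_pow]
    push_cast
    ring
  have hcB : (c : ℝ) * Real.log B = 3 * Real.log ((4 * xP ^ 3 - 28 * xP + 24) ^ 2 / 125) := by
    rw [hlogq]
    linarith
  -- interval-log relation: `c•[log B] − 3•[log (f(x_P)²/125)] ∈ relations`
  have hlog : c • KZ.of rB + (-3 : ℤ) • KZ.of rL ∈ KZ.relations := by
    have h := interval_log_relation_mem_relations 2 ![1, 1]
      ![B, (4 * xP ^ 3 - 28 * xP + 24) ^ 2 / 125] ![c, -3] ![rB, rL] ?_ ?_ ?_ ?_ ?_ ?_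
    · simpa [Fin.sum_univ_two] using h
    · intro i; fin_cases i <;> simp
    · intro i; fin_cases i
      · simpa using hB1.le
      · simpa using hsq
    · intro i; fin_cases i <;> simpa using isAlgebraic_one
    · intro i; fin_cases i
      · simpa using hBalg
      · simpa using hfalg
    · intro i; fin_cases i
      · exact ⟨hBdom, fun z hz => (hBint hz).trans (one_div (z 0)).symm⟩
      · exact ⟨hLdom, fun z hz => (hLint hz).trans (one_div (z 0)).symm⟩
    · simp only [Fin.sum_univ_two, Matrix.cons_val_zero, Matrix.cons_val_one, div_one, Int.cast_neg,
        Int.cast_ofNat]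
      rw [hcB]
      ring
  -- assemble: `36•[rI] + [rP] − 3•[rL] = (rung element) + (log relation)`
  have key : (36 : ℤ) • KZ.of rI + KZ.of rP - (3 : ℤ) • KZ.of rL
      = ((36 : ℤ) • KZ.of rI + KZ.of rP - c • KZ.of rB) + (c • KZ.of rB + (-3 : ℤ) • KZ.of rL) := by
    module
  rw [key]
  exact KZ.relations.add_mem hchain' hlog

/-- **The crux `TorsionLogs.NeronTorsionFlex`, by name, from the two registered stubs.** -/
theorem NeronTorsionFlex_of :
    Summit.KontsevichZagierPeriods.KontsevichZagierPeriods.Theses.TorsionLogs.NeronTorsionFlex :=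
  NeronTorsionFlex_of_stubs stub_neronTorsionHeightChain stub_flexTorsionData

end Summit.KontsevichZagierPeriods.KontsevichZagierPeriods.Cruxes.NeronTorsionFlex.NeronHeight
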